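import Summits.HubbardSuperconductivity.HubbardSuperconductivity.Theorems.AnisotropyChordTransferFibre3FinX3Eval
import Summits.HubbardSuperconductivity.HubbardSuperconductivity.Theorems.AnisotropyChordTransferFibre3FinX3T25c098

/-!
# Route `AnisotropyChord` / H0 rotor rung: FIN per-`L` GM₃ (X4), `L = 25` — row-C cell fact of cell 98

Kernel fact `xcCellAnyT0 25 (49/50) 100 963105899066166 987183546542821 73 tb = true` (row C of cert cell 98 with `b = 73/100` and the `T⁺·D` brackets `tb` exported by the row-`N₁` fact `xn25_98`): the recomputed tables are rewritten to the certified literals of `…FinX3T25c098` and the check is decided by the kernel; assembled in `…FinX3GM3TwentyFive`.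
Prover seat `hubbard-h0-rotor-p3` g8; helper for piece A = stmt-HubbardSuperconductivity-23918 of rung 19089 (`--supports`, helper class).
WHAT THIS IS NOT: nothing here proves superconductivity in the Hubbard model (rotor TARGET as worded stays FALSE, g15 verdict); kernel facts for the FIN certificate of ONE conditional reduction.  Tree imports only; zero data; standard axioms.
-/

set_option linter.dupNamespace false
set_option autoImplicit false

namespace Summit.HubbardSuperconductivity.HubbardSuperconductivity.Theorems.AnisotropyChord.Transfer.Fibre3

namespace FinXD

open FinXB FinCell Hole2

set_option maxHeartbeats 4000000 in
/-- row C of cell 98 of `L = 25` (`b = 73/100`). [folklore] -/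
theorem xc25_98 : xcCellAnyT0 25 (49/50 : ℚ) 100 963105899066166 987183546542821 73 ((2891291053120703 : ℤ), (2971529493288523 : ℤ)) = true := by
  unfold xcCellAnyT0
  rw [tf25_98_eq, tg25_98_eq]
  decide +kernel

end FinXD

end Summit.HubbardSuperconductivity.HubbardSuperconductivity.Theorems.AnisotropyChord.Transfer.Fibre3
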